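import Summits.BirchSwinnertonDyer.BirchSwinnertonDyer.Theorems.SignedLowerHalvesSmallImageLowerHalfBothSignsRttCharRoadE1ResidualCharacter
import Literature.NumberTheory.EllipticCurves.OrdinaryPrimesProofs
import Literature.NumberTheory.EllipticCurves.GoodReductionUnramifiedProofs
import Literature.NumberTheory.EllipticCurves.GaloisActionProofs
import HarnessLib

/-!
# Route `SignedLowerHalves`, crux L `SmallImageLowerHalfBothSigns` (item stmt-BirchSwinnertonDyer-23599), line `rtt_w3` v9 —
# conjunct E1 of `stub_charRoad_ns`, brick E1-a (global form): `θ̄ = χ` OR `θ̄ = χᶜ` on all of `Γ_K`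

Width seat `bsd-line-slh-p3-w3` g16 under LEAD `cruxlead-stmt-BirchSwinnertonDyer-23599` g6; helper `--supports stmt-BirchSwinnertonDyer-23599`;
THEOREMS ONLY, no `sorry`; closes nothing; BSD / crux L / E1 / COUNT are NOT proved by this.

Sequel of `…RttCharRoadE1ResidualCharacter.lean` (the POINTWISE alternative `residualChar_frob_eq_or_eq` at the Frobenii of the split
degree-one primes). HERE ★ `residualChar_eq_or_eq_conj`: on the registered prefix binders of `stub_charRoad_ns` (Cartan frame `Φ, k, e₀`,
quadratic `K` with `ρ̄(Γ_K) ⊆ kˣ`, Grössencharakter `ψ mod 𝔪` with centrality `hneb` and congruence `htrace`, the pinned integral character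
`θ` of JD), B3′'s eigencharacter `χ : U → k'ˣ` with its formula clause and an element `c` with `Φρ̄(c) ∉ kˣ`, and ANY ring map
`r : 𝒪_S → k'` killing `{‖x‖ < 1}`: EITHER `r(θ(τ)₀₀) = χ(res τ)` for all `τ ∈ Γ_K` OR `r(θ(τ)₀₀) = χ(c·res τ·c⁻¹)` for all `τ ∈ Γ_K`.
Proof: the three maps are continuous characters `Γ_K → k'ˣ` for the discrete topology on `k'` (kernels open:
`isOpen_ker_galoisRepTorsion_holds` pulled back along `absGaloisRestrict`; `r ∘ θ` is locally constant because `θ` is continuous and `r` kills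
the open unit ball); the pointwise alternative holds at every arithmetic Frobenius above every place of prime absolute norm outside the finite
set of places dividing `N₀ = 2·p·d_K·N(𝔪)·Δ_min(W)`; such places have Dirichlet density one (`hasDirichletDensity_one_setOf_prime_absNorm`,
`HasDirichletDensity.diff_of_finite`), and `absoluteGaloisGroup.monoidHom_eq_or_eq_of_frobenius'` (no group is a union of two proper
subgroups) concludes. Consumer: E1-b / COUNT (LEAD g6, p762890): `W[p] ⊗ k_S ≃ Coind k_S(θ̄)` through B3′ (`Coind χ ≃ Coind χᶜ`).

References: [Serre1972] §2.2, §4.2 c); [SerreAbelianLadic1968] Ch. I §2.3; [NeukirchANT1999] Ch. VII §13; [Liu2021] App. D; [Rubin1991] §4.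
-/

set_option autoImplicit false
-- D-0017: single-problem summit, the namespace repeats the problem name by design.
set_option linter.dupNamespace false
noncomputable section

open scoped NumberField MatrixGroups Classical
open NumberField IsDedekindDomain Field Polynomial Matrix WeierstrassCurve Rat.HeightOneSpectrum
  Literature.NumberTheory.GaloisRepresentations Literature.NumberTheory.EllipticCurves Literature.NumberTheory.LFunctions
  Literature.NumberTheory.LFunctions.NumberField
  Literature.NumberTheory.GaloisRepresentations.Serre1972
  Summit.BirchSwinnertonDyer.BirchSwinnertonDyer.Theorems.SmallImageLambdaLowerThreeNsThetaPartner

namespace Summit.BirchSwinnertonDyer.BirchSwinnertonDyer.Theorems.SmallImageRttCharRoad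

/-- A homomorphism into a group with OPEN kernel is locally constant.
-- adapted from Literature/NumberTheory/GaloisRepresentations/CharacterPrescribedLocalComponentsProofs.lean (private there)
[folklore] -/
private theorem isLocallyConstant_of_isOpen_ker' {Γ G : Type*} [Group Γ] [TopologicalSpace Γ]
    [ContinuousMul Γ] [Group G] (f : Γ →* G) (h : IsOpen (f.ker : Set Γ)) : IsLocallyConstant f := by
  refine (IsLocallyConstant.iff_exists_open f).2 fun σ => ⟨{τ | σ⁻¹ * τ ∈ f.ker}, ?_, ?_, ?_⟩
  · exact h.preimage (continuous_const_mul σ⁻¹)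
  · show σ⁻¹ * σ ∈ f.ker
    rw [inv_mul_cancel]; exact f.ker.one_mem
  · intro τ hτ
    have hτ' : f (σ⁻¹ * τ) = 1 := hτ
    rw [map_mul, map_inv, inv_mul_eq_one] at hτ'
    exact hτ'.symm

section Global

variable (W : WeierstrassCurve ℚ) [W.IsElliptic] [W.IsGloballyMinimal] (p : ℕ) [Fact p.Prime]
  (Φ : Multiplicative (AddAut (geomTorsion W p)) ≃* GL (Fin 2) (ZMod p))
  {k : Subalgebra (ZMod p) (Matrix (Fin 2) (Fin 2) (ZMod p))}
  (K : Type) [Field K] [NumberField K]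

/-- ★★ **E1-a: the residual character of `θ = ψ_𝔭` is one of the two eigencharacters of `ρ̄_{W,p}|_{Γ_K}`.** Setting of
`…RttCharRoadE1ResidualCharacter` (module docstring). For every ring map `r : 𝒪_S → k'` with `r x = 0` whenever `‖x‖ < 1`:
EITHER `∀ τ, r(θ(τ)₀₀) = χ(res τ)` OR `∀ τ, r(θ(τ)₀₀) = χ(c·res τ·c⁻¹)`. (The embedding of residue fields is the consumer's choice of
`r` and of the root `lam ∈ k'` framing `χ`.) [cite: Serre1972, §2.2, §4.2 c)] [cite: SerreAbelianLadic1968, Ch. I §2.3]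
[cite: NeukirchANT1999, Ch. VII §13] [cite: Liu2021, App. D, proof of Thm. D.6 (1)] -/
theorem residualChar_eq_or_eq_conj (hk : IsField k) (h2k : Module.finrank (ZMod p) k = 2)
    (e₀ : geomTorsion W p ≃+ (Fin 2 → ZMod p))
    (he₀ : ∀ (g : Multiplicative (AddAut (geomTorsion W p))) (x : geomTorsion W p),
      e₀ (Multiplicative.toAdd g x) = ((Φ g : GL (Fin 2) (ZMod p)) : Matrix (Fin 2) (Fin 2) (ZMod p)) *ᵥ e₀ x)
    (htr : letI : Module (ZMod p) (geomTorsion W p) := AddSubgroup.torsionBy.zmodModule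
      ∀ g : Multiplicative (AddAut (geomTorsion W p)),
        Matrix.trace ((Φ g : GL (Fin 2) (ZMod p)) : Matrix (Fin 2) (Fin 2) (ZMod p)) =
          LinearMap.trace (ZMod p) (geomTorsion W p) ((Multiplicative.toAdd g).toAddMonoidHom.toZModLinearMap p))
    (hGN : (galoisRepTorsion W p).range.map Φ.toMonoidHom ≤
      Subgroup.normalizer (Serre1972.unitGroup k : Set (GL (Fin 2) (ZMod p))))
    (hK2 : Module.finrank ℚ K = 2)
    (hKU : ∀ τ : absoluteGaloisGroup K, Φ (galoisRepTorsion W p (absGaloisRestrict ℚ K τ)) ∈ Serre1972.unitGroup k)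
    (𝔪 : Ideal (𝓞 K)) (h𝔪 : 𝔪 ≠ ⊥) (ψ : HeightOneSpectrum (𝓞 K) → ℂ) (e : PadicAlgCl p ≃+* ℂ)
    (hneb : ∀ n : ℕ, Odd n → n.Coprime ((NumberField.discr K).natAbs * Ideal.absNorm 𝔪) →
      idealPow K ψ (Ideal.span {(n : 𝓞 K)}) = (jacobiSym (NumberField.discr K) n : ℂ) * (n : ℂ) ^ (2 - 1))
    (htrace : ∀ (ℓ : ℕ) [Fact ℓ.Prime], ℓ ≠ p → W.HasGoodReductionAtPrime ℓ →
      ‖e.symm (∑ᶠ (w : HeightOneSpectrum (𝓞 K)) (_ : Ideal.absNorm w.asIdeal = ℓ), ψ w) -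
        (W.frobeniusTrace ℓ : PadicAlgCl p)‖ < 1)
    {S : Set (PadicAlgCl p)} (θ : FramedGaloisRep K (padicCoeffIntegers S) 1)
    (hθ : ∀ w : HeightOneSpectrum (𝓞 K), (p : 𝓞 K) ∉ w.asIdeal → ¬ 𝔪 ≤ w.asIdeal →
      θ.IsUnramifiedAt w ∧ ∃ P : Polynomial (padicCoeffIntegers S),
        P.map (padicCoeffIntegers S).subtype = X - C (e.symm (ψ w)) ∧ θ.HasFrobCharpolyAt w P)
    {k' : Type} [Field k'] [Algebra (ZMod p) k'] (r : padicCoeffIntegers S →+* k')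
    (hr : ∀ x : padicCoeffIntegers S, ‖(x : PadicAlgCl p)‖ < 1 → r x = 0)
    {y₀ : Matrix (Fin 2) (Fin 2) (ZMod p)} (hy₀ : y₀ ∈ k) (hys : ∀ c : ZMod p, y₀ ≠ c • 1) (lam : k')
    (χ : (Serre1972.unitGroup k).comap (Φ.toMonoidHom.comp (galoisRepTorsion W p)) →* k'ˣ)
    (hχ : ∀ (u : (Serre1972.unitGroup k).comap (Φ.toMonoidHom.comp (galoisRepTorsion W p))) (a b : ZMod p),
      ((Φ (galoisRepTorsion W p (u : absoluteGaloisGroup ℚ)) : GL (Fin 2) (ZMod p)) : Matrix (Fin 2) (Fin 2) (ZMod p)) =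
          a • (1 : Matrix (Fin 2) (Fin 2) (ZMod p)) + b • y₀ →
        ((χ u : k'ˣ) : k') = algebraMap (ZMod p) k' a + algebraMap (ZMod p) k' b * lam)
    (c : absoluteGaloisGroup ℚ) (hc : Φ (galoisRepTorsion W p c) ∉ Serre1972.unitGroup k) :
    (∀ τ : absoluteGaloisGroup K,
        r ((((θ τ : GL (Fin 1) (padicCoeffIntegers S)) : Matrix (Fin 1) (Fin 1) (padicCoeffIntegers S)) 0 0)) =
          ((χ ⟨absGaloisRestrict ℚ K τ, hKU τ⟩ : k'ˣ) : k')) ∨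
      (∀ τ : absoluteGaloisGroup K,
        r ((((θ τ : GL (Fin 1) (padicCoeffIntegers S)) : Matrix (Fin 1) (Fin 1) (padicCoeffIntegers S)) 0 0)) =
          ((χ ⟨c * absGaloisRestrict ℚ K τ * c⁻¹, conj_mem_of_mem W p Φ hGN c (hKU τ)⟩ : k'ˣ) : k')) := by
  have hp : p.Prime := Fact.out
  -- the discrete topology on `k'`
  letI : TopologicalSpace k' := ⊥
  haveI : DiscreteTopology k' := ⟨rfl⟩
  -- the three characters `Γ_K →* k'ˣ`
  let resU : absoluteGaloisGroup K →* (Serre1972.unitGroup k).comap (Φ.toMonoidHom.comp (galoisRepTorsion W p)) :=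
    ((absGaloisRestrict ℚ K : absoluteGaloisGroup K →ₜ* absoluteGaloisGroup ℚ) :
      absoluteGaloisGroup K →* absoluteGaloisGroup ℚ).codRestrict _ fun τ => hKU τ
  let conjU : (Serre1972.unitGroup k).comap (Φ.toMonoidHom.comp (galoisRepTorsion W p)) →*
      (Serre1972.unitGroup k).comap (Φ.toMonoidHom.comp (galoisRepTorsion W p)) :=
    ((MulAut.conj c).toMonoidHom.comp (Subgroup.subtype _)).codRestrict _ fun u => conj_mem_of_mem W p Φ hGN c u.2
  let χ₁ : absoluteGaloisGroup K →* k'ˣ := χ.comp resU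
  let χ₂ : absoluteGaloisGroup K →* k'ˣ := χ.comp (conjU.comp resU)
  let θr : absoluteGaloisGroup K →* k'ˣ :=
    (Units.map (r : padicCoeffIntegers S →* k')).comp
      ((Matrix.GeneralLinearGroup.det : GL (Fin 1) (padicCoeffIntegers S) →* (padicCoeffIntegers S)ˣ).comp
        (θ : absoluteGaloisGroup K →* GL (Fin 1) (padicCoeffIntegers S)))
  have hθr : ∀ τ, ((θr τ : k'ˣ) : k') =
      r ((((θ τ : GL (Fin 1) (padicCoeffIntegers S)) : Matrix (Fin 1) (Fin 1) (padicCoeffIntegers S)) 0 0)) := by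
    intro τ
    show r (Matrix.GeneralLinearGroup.det (θ τ) : padicCoeffIntegers S) = _
    rw [Matrix.GeneralLinearGroup.val_det_apply, Matrix.det_fin_one]
  have hχ₁ : ∀ τ, χ₁ τ = χ ⟨absGaloisRestrict ℚ K τ, hKU τ⟩ := fun τ => rfl
  have hχ₂ : ∀ τ, χ₂ τ = χ ⟨c * absGaloisRestrict ℚ K τ * c⁻¹, conj_mem_of_mem W p Φ hGN c (hKU τ)⟩ := fun τ => rfl
  -- continuity (locally constant maps into the discrete `k'`)
  have hp0 : (p : ℤ) ≠ 0 := by exact_mod_cast hp.ne_zero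
  have hkerρ : IsOpen ((((galoisRepTorsion W p).ker.comap
      ((absGaloisRestrict ℚ K : absoluteGaloisGroup K →ₜ* absoluteGaloisGroup ℚ) :
        absoluteGaloisGroup K →* absoluteGaloisGroup ℚ)) : Subgroup (absoluteGaloisGroup K)) : Set (absoluteGaloisGroup K)) :=
    (isOpen_ker_galoisRepTorsion_holds W hp0).preimage (absGaloisRestrict ℚ K).continuous
  have hker₁ : IsOpen ((χ₁.ker : Subgroup (absoluteGaloisGroup K)) : Set (absoluteGaloisGroup K)) := by
    apply Subgroup.isOpen_mono (H₁ := (galoisRepTorsion W p).ker.comap _) _ hkerρ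
    intro τ hτ
    have hτ' : galoisRepTorsion W p (absGaloisRestrict ℚ K τ) = 1 := hτ
    rw [MonoidHom.mem_ker]
    have h1 : ((Φ (galoisRepTorsion W p ((resU τ : _) : absoluteGaloisGroup ℚ)) : GL (Fin 2) (ZMod p)) :
        Matrix (Fin 2) (Fin 2) (ZMod p)) = (1 : ZMod p) • 1 + (0 : ZMod p) • y₀ := by
      show ((Φ (galoisRepTorsion W p (absGaloisRestrict ℚ K τ)) : GL (Fin 2) (ZMod p)) : Matrix (Fin 2) (Fin 2) (ZMod p)) = _
      rw [hτ', map_one, Units.val_one, one_smul, zero_smul, add_zero]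
    have h := hχ (resU τ) 1 0 h1
    rw [map_one, map_zero, zero_mul, add_zero] at h
    exact Units.ext h
  have hker₂ : IsOpen ((χ₂.ker : Subgroup (absoluteGaloisGroup K)) : Set (absoluteGaloisGroup K)) := by
    apply Subgroup.isOpen_mono (H₁ := (galoisRepTorsion W p).ker.comap _) _ hkerρ
    intro τ hτ
    have hτ' : galoisRepTorsion W p (absGaloisRestrict ℚ K τ) = 1 := hτ
    rw [MonoidHom.mem_ker]
    have h1 : ((Φ (galoisRepTorsion W p ((conjU (resU τ) : _) : absoluteGaloisGroup ℚ)) : GL (Fin 2) (ZMod p)) :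
        Matrix (Fin 2) (Fin 2) (ZMod p)) = (1 : ZMod p) • 1 + (0 : ZMod p) • y₀ := by
      show ((Φ (galoisRepTorsion W p (c * absGaloisRestrict ℚ K τ * c⁻¹)) : GL (Fin 2) (ZMod p)) :
        Matrix (Fin 2) (Fin 2) (ZMod p)) = _
      simp only [map_mul, map_inv, hτ', map_one, mul_one, mul_inv_cancel, Units.val_one, one_smul, zero_smul, add_zero]
    have h := hχ (conjU (resU τ)) 1 0 h1
    rw [map_one, map_zero, zero_mul, add_zero] at h
    exact Units.ext h
  have hcont₁ : Continuous ((Units.val : k'ˣ → k') ∘ χ₁) :=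
    continuous_of_discreteTopology.comp (isLocallyConstant_of_isOpen_ker' χ₁ hker₁).continuous
  have hcont₂ : Continuous ((Units.val : k'ˣ → k') ∘ χ₂) :=
    continuous_of_discreteTopology.comp (isLocallyConstant_of_isOpen_ker' χ₂ hker₂).continuous
  have hcontθ : Continuous ((Units.val : k'ˣ → k') ∘ θr) := by
    -- `τ ↦ θ(τ)₀₀ ∈ ℚ̄_p` is continuous and `r` is constant on balls of radius `1`
    have hA : Continuous fun τ : absoluteGaloisGroup K =>
        ((((θ τ : GL (Fin 1) (padicCoeffIntegers S)) : Matrix (Fin 1) (Fin 1) (padicCoeffIntegers S)) 0 0 :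
          padicCoeffIntegers S) : PadicAlgCl p) :=
      continuous_subtype_val.comp ((Units.continuous_val.comp θ.continuous).matrix_elem 0 0)
    refine (IsLocallyConstant.iff_exists_open _).2 (fun τ₀ => ?_) |>.continuous
    refine ⟨{τ | ‖((((θ τ : GL (Fin 1) (padicCoeffIntegers S)) : Matrix (Fin 1) (Fin 1) (padicCoeffIntegers S)) 0 0 :
          padicCoeffIntegers S) : PadicAlgCl p) -
        ((((θ τ₀ : GL (Fin 1) (padicCoeffIntegers S)) : Matrix (Fin 1) (Fin 1) (padicCoeffIntegers S)) 0 0 :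
          padicCoeffIntegers S) : PadicAlgCl p)‖ < 1}, ?_, by simp, fun τ hτ => ?_⟩
    · exact (isOpen_lt (continuous_norm.comp (hA.sub continuous_const)) continuous_const)
    · simp only [Function.comp_apply, hθr]
      have h := hr ((((θ τ : GL (Fin 1) (padicCoeffIntegers S)) : Matrix (Fin 1) (Fin 1) (padicCoeffIntegers S)) 0 0) -
        (((θ τ₀ : GL (Fin 1) (padicCoeffIntegers S)) : Matrix (Fin 1) (Fin 1) (padicCoeffIntegers S)) 0 0))
        (by push_cast; exact hτ)
      rw [map_sub, sub_eq_zero] at h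
      exact h
  -- the exceptional set of places
  set N₀ : ℕ := 2 * p * (NumberField.discr K).natAbs * Ideal.absNorm 𝔪 * (minimalDiscriminantInt W).natAbs with hN₀
  have hN₀0 : N₀ ≠ 0 := by
    have h1 : (NumberField.discr K).natAbs ≠ 0 := Int.natAbs_ne_zero.mpr (NumberField.discr_ne_zero K)
    have h2 : Ideal.absNorm 𝔪 ≠ 0 := by rwa [Ne, Ideal.absNorm_eq_zero_iff]
    have h3 : (minimalDiscriminantInt W).natAbs ≠ 0 := Int.natAbs_ne_zero.mpr (minimalDiscriminantInt_ne_zero W)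
    exact mul_ne_zero (mul_ne_zero (mul_ne_zero (mul_ne_zero two_ne_zero hp.ne_zero) h1) h2) h3
  set Sx : Set (HeightOneSpectrum (𝓞 K)) := {w | (N₀ : 𝓞 K) ∈ w.asIdeal} with hSx
  have hSxfin : Sx.Finite := IsDedekindDomain.HeightOneSpectrum.finite_setOf_natCast_mem hN₀0
  -- density-one two-alternatives rigidity
  have key := absoluteGaloisGroup.monoidHom_eq_or_eq_of_frobenius' (K := K) (M := k'ˣ) (X := k')
    (f := (Units.val : k'ˣ → k')) (fun _ _ h => Units.ext h)
    ((hasDirichletDensity_one_setOf_prime_absNorm K).diff_of_finite hSxfin)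
    (ψ := θr) (χ₁ := χ₁) (χ₂ := χ₂) hcontθ hcont₁ hcont₂ ?_
  · rcases key with h | h
    · left; intro τ; rw [← hθr, ← hχ₁, h]
    · right; intro τ; rw [← hθr, ← hχ₂, h]
  -- the pointwise alternative at a place `w ∉ Sx` of prime norm `ℓ`
  rintro w ⟨hwprime, hwS⟩ 𝔔 h𝔔 F hF
  set ℓ := Ideal.absNorm w.asIdeal with hℓdef
  haveI : Fact ℓ.Prime := ⟨hwprime⟩
  have hℓN : ¬ ℓ ∣ N₀ := by
    intro hdvd
    apply hwS
    show (N₀ : 𝓞 K) ∈ w.asIdeal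
    obtain ⟨m, hm⟩ := hdvd
    rw [hm, Nat.cast_mul]
    exact Ideal.mul_mem_right _ _ (natCast_mem_of_absNorm_eq' rfl)
  have hndvd : ∀ m : ℕ, m ∣ N₀ → ¬ ℓ ∣ m := fun m hm h => hℓN (h.trans hm)
  have hℓ2 : ℓ ≠ 2 := fun h => hndvd 2 ⟨p * (NumberField.discr K).natAbs * Ideal.absNorm 𝔪 * (minimalDiscriminantInt W).natAbs,
    by rw [hN₀]; ring⟩ (h ▸ dvd_rfl)
  have hℓp : ℓ ≠ p := fun h => hndvd p ⟨2 * (NumberField.discr K).natAbs * Ideal.absNorm 𝔪 * (minimalDiscriminantInt W).natAbs,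
    by rw [hN₀]; ring⟩ (h ▸ dvd_rfl)
  have hℓD : ¬ (ℓ : ℤ) ∣ NumberField.discr K := fun h =>
    hndvd (NumberField.discr K).natAbs ⟨2 * p * Ideal.absNorm 𝔪 * (minimalDiscriminantInt W).natAbs, by rw [hN₀]; ring⟩
      (Int.natCast_dvd.mp h)
  have hℓ𝔪 : ¬ ℓ ∣ Ideal.absNorm 𝔪 := hndvd _ ⟨2 * p * (NumberField.discr K).natAbs * (minimalDiscriminantInt W).natAbs,
    by rw [hN₀]; ring⟩
  have hgood : W.HasGoodReductionAtPrime ℓ := hasGoodReductionAtPrime_of_not_dvd W ℓ fun h =>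
    hndvd (minimalDiscriminantInt W).natAbs ⟨2 * p * (NumberField.discr K).natAbs * Ideal.absNorm 𝔪, by rw [hN₀]; ring⟩
      (Int.natCast_dvd.mp h)
  have hpt := residualChar_frob_eq_or_eq W p Φ K hk h2k e₀ he₀ htr hGN hK2 hKU 𝔪 ψ e hneb htrace θ hθ r hr hy₀ hys lam χ hχ c hc
    (hℓdef.symm) hℓ2 hℓp hℓD hℓ𝔪 hgood h𝔔 hF
  rcases hpt with h | h
  · left; exact Units.ext (by rw [hθr, hχ₁]; exact h)
  · right; exact Units.ext (by rw [hθr, hχ₂]; exact h)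

end Global

end Summit.BirchSwinnertonDyer.BirchSwinnertonDyer.Theorems.SmallImageRttCharRoad

end
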